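import Summits.CriticalPhenomena.CardyFormulaZ2.Theorems.CardyBoundaryCoulombGasStripClusterRatesBandRateSum

/-!
# BK–Reimer three-arm bound for the two-cluster event: from the product bound to the rate inequality

Crux `StripClusterRates` (stmt-CriticalPhenomena-13878), line two-cluster-rate-is-stationary-gap,
BK–Reimer three-arm bound of the lead: once the two-cluster probability `q m = p₂(m,n)` is
dominated by the product `p₁(m,n)²·p₁(m+1,n-1)` of one-cluster crossing probabilities for every
length `m`, the corresponding exponential rates satisfy `2γa + γb ≤ γ₂`.

This file is the pure real-analysis step, with the dominated positive sequence `q` kept abstract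
(`arm_rate_ge_of_le_prod`): all factors are positive (`pOne_ge : p₁(m,n) ≥ 2⁻ᵐ`), so take
logarithms in the product bound, divide by `m` and pass to the limit (`le_of_tendsto_of_tendsto'`;
at `m = 0` both sides are the junk value `0`), the shifted factor's rate sequence
`-log p₁(m+1,n-1)/m` having the limit `γb` by the landed `band_rate_tendsto_shift`.
-/

noncomputable section

open MeasureTheory Filter Topology
open Literature.Probability.LatticeModels Literature.Probability.Percolation

namespace Summit.CriticalPhenomena.CardyFormulaZ2.Cruxes.StripClusterRates.TwoClusterRateIsStationaryGap

open Summit.CriticalPhenomena.CardyFormulaZ2.Theorems.StripClusterRates.Negative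

/-- **From the product upper bound to the rate lower bound.** If `0 < q m ≤ p₁(m,n)²·p₁(m+1,n-1)`
for every `m`, and `-log p₁(m,n)/m → γa`, `-log p₁(m,n-1)/m → γb`, `-log (q m)/m → γ₂`, then
`2γa + γb ≤ γ₂`: take logarithms (all factors are positive as `p₁(m,n) ≥ 2⁻ᵐ`, tree `pOne_ge`),
divide by `m` and pass to the limit, the shifted factor's rate sequence having the limit `γb` by
`band_rate_tendsto_shift`. [folklore] -/
theorem arm_rate_ge_of_le_prod : ∀ (n : ℕ) (q : ℕ → ℝ) (γa γb γ₂ : ℝ), (∀ m : ℕ, 0 < q m) →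
    (∀ m : ℕ, q m ≤ crossingProb half m n ^ 2 * crossingProb half (m + 1) (n - 1)) →
    Tendsto (fun m : ℕ ↦ -Real.log (crossingProb half m n) / (m : ℝ)) atTop (𝓝 γa) →
    Tendsto (fun m : ℕ ↦ -Real.log (crossingProb half m (n - 1)) / (m : ℝ)) atTop (𝓝 γb) →
    Tendsto (fun m : ℕ ↦ -Real.log (q m) / (m : ℝ)) atTop (𝓝 γ₂) → 2 * γa + γb ≤ γ₂ := by
  intro n q γa γb γ₂ hq hle ha hb h₂
  refine le_of_tendsto_of_tendsto' ((ha.const_mul 2).add (band_rate_tendsto_shift hb)) h₂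
    fun m ↦ ?_
  have hpos : ∀ k l : ℕ, 0 < crossingProb half k l := fun k l ↦
    lt_of_lt_of_le (by positivity) (pOne_ge k l)
  have hpa := hpos m n
  have hpb := hpos (m + 1) (n - 1)
  have hlog := Real.log_le_log (hq m) (hle m)
  rw [Real.log_mul (pow_pos hpa 2).ne' hpb.ne', Real.log_pow] at hlog
  push_cast at hlog
  rw [mul_div_assoc', ← add_div]
  exact div_le_div_of_nonneg_right (by linarith) (Nat.cast_nonneg m)

end Summit.CriticalPhenomena.CardyFormulaZ2.Cruxes.StripClusterRates.TwoClusterRateIsStationaryGap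

end
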